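import Summits.ResolutionOfSingularities.ResolutionOfSingularities.Theorems.EquisingularLiftEquisingularLiftNatAffineOneStepBridge
import Summits.ResolutionOfSingularities.ResolutionOfSingularities.Theorems.EquisingularLiftEquisingularLiftNatNDTransportInit
import Summits.ResolutionOfSingularities.ResolutionOfSingularities.Theorems.EquisingularLiftEquisingularLiftNatSecondOrderALadder
import HarnessLib

/-!
# [OURS] THE AFFINE ONE-STEP BRIDGE in the TOWER'S currency: the origin of `Spec K[y]/(Φ + Ψ)` with one-step data is a ONE-STEP POINT in the
# intrinsic sense «every blow-up at the reduced closed point is regular over it» (= level `0` of every blow-up tower, ✓ `towerLevel_zero_of_model`)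
# (cruxes `Theses.EquisingularLift.EquisingularLiftNat` / `…NatThree` / `EquisingularLift`, stmt-ResolutionOfSingularities-20038 / -20148 / -15660)

[OURS · leafhand-res-equisingularlift-11 g0, 2026-08-31; cell `pub/decomp-res`] AI-produced, weaker than expert review; NOT a statement of any manuscript;
nothing here proves resolution of singularities in positive characteristic.  DEF-FREE helper; no `sorry`; standard axioms; ZERO named hypotheses.

✓ `OneStep.isRegularLocalRing_stalk_of_isBlowup_origin` (…NatAffineOneStepBridge, p832926) speaks of blow-ups along the ideal sheaf `ofIdealTop (ȳ)`
and of points over its support.  The depth towers (leafhand-10: `hD0` of ✓ `towerLevel_zero_of_model` / ✓ `tower_loc` / ✓ `PointChain.chain_of_oneStepPoints`)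
speak of blow-ups along `vanishingIdeal {y}` of a CLOSED POINT `y` and of the points `z` with `τ z = y`.  This file is the dictionary:

* `OneStep.isMaximal_span_range_X'` — `(y₀, …, y_N)` is a maximal ideal of `K[y]`;
* `OneStep.add_mem_span_range_X` — `Φ + Ψ ∈ (y)` for a form `Φ` of degree `μ ≥ 1` and `Ψ ∈ (y)^{μ+1}`;
* `OneStep.isMaximal_map_mk_span_range_X` — its image `(ȳ)` in `K[y]/(Φ + Ψ)` is maximal (the origin lies on the hypersurface);
* ★★★ `OneStep.oneStepAt_origin` — for the point `y₀ ∈ Spec (K[y]/(Φ + Ψ))` with `y₀.asIdeal = (ȳ)` and one-step data (hone): for every blow-up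
  `τ : Z → Spec (K[y]/(Φ + Ψ))` along `vanishingIdeal {y₀}` and every `z` with `τ z = y₀`, `𝒪_{Z,z}` is regular — VERBATIM the hypothesis `hone` of
  ✓ `isoHypPoint_of_oneStepPoints` / the level-`0` clause `hD0` of the towers, at the origin of an affine hypersurface (✓ `singleton_eq_zeroLocus_of_isMaximal`,
  ✓ `vanishingIdeal_zeroLocus_eq_ofIdealTop_of_isRadical` turn the closed point into `ofIdealTop (ȳ)`).

With ✓ `tower_loc` (locality along an open immersion) this gives level `0` at any point of any scheme that has an open neighbourhood isomorphic to an
open of such an affine hypersurface around its origin — in particular at the chart origins of a first blow-up, where ✓ …SecondOrderA3Recognition /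
…SecondOrderALadder / …SecondOrderDLadder supply (hone).  Remaining for level `1` (census B2–B4): the identification of the exceptional non-regular points
of the glued model with those chart origins, and their finiteness/closedness.  Honest label: closes no registered stub.

References: [StacksProject, Tags 0804, 080E, 00E0]; [GortzWedhorn2020, Prop. 13.91]; through the cited tree files.
-/

set_option linter.dupNamespace false -- mandated namespace `Summit.<Summit>.<Problem>` of this single-conjunct summit

noncomputable section

open CategoryTheory CategoryTheory.Limits AlgebraicGeometry TopologicalSpace
open MvPolynomial
open Literature.AlgebraicGeometry.Resolution
open AlgebraicGeometry.Scheme.IdealSheafData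
open Summit.ResolutionOfSingularities.ResolutionOfSingularities.Cruxes.EquisingularLiftNat.Sections.ND

namespace Summit.ResolutionOfSingularities.ResolutionOfSingularities.Cruxes.EquisingularLiftNat.Sections

namespace OneStep

/-- `(y₀, …, y_N)` is a maximal ideal of `K[y]` (the kernel of the constant coefficient onto the field `K`). [folklore] -/
theorem isMaximal_span_range_X' (K : Type) [Field K] {N : ℕ} :
    (Ideal.span (Set.range (X : Fin (N + 1) → MvPolynomial (Fin (N + 1)) K))).IsMaximal := by
  have hker : RingHom.ker (constantCoeff : MvPolynomial (Fin (N + 1)) K →+* K) =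
      Ideal.span (Set.range (X : Fin (N + 1) → MvPolynomial (Fin (N + 1)) K)) := by
    ext f
    change f ∈ RingHom.ker _ ↔ f ∈ MvPolynomial.idealOfVars (Fin (N + 1)) K
    rw [RingHom.mem_ker, ← pow_one (MvPolynomial.idealOfVars (Fin (N + 1)) K), MvPolynomial.mem_pow_idealOfVars_iff']
    constructor
    · intro h x hx
      rw [Nat.lt_one_iff, Finsupp.degree_eq_zero_iff] at hx
      subst hx
      exact h
    · intro h
      exact h 0 (by simp)
  rw [← hker]
  exact RingHom.ker_isMaximal_of_surjective _ fun a => ⟨C a, constantCoeff_C _ a⟩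

/-- `Φ + Ψ ∈ (y)` for a form `Φ` of degree `μ ≥ 1` and `Ψ ∈ (y)^{μ+1}`: the origin lies on the hypersurface. [folklore] -/
theorem add_mem_span_range_X (K : Type) [Field K] {N : ℕ} (Φ Ψ : MvPolynomial (Fin (N + 1)) K) {μ : ℕ} (hμ : 1 ≤ μ)
    (hΦ : Φ.IsHomogeneous μ) (hΨ : Ψ ∈ Ideal.span (Set.range (X : Fin (N + 1) → MvPolynomial (Fin (N + 1)) K)) ^ (μ + 1)) :
    Φ + Ψ ∈ Ideal.span (Set.range (X : Fin (N + 1) → MvPolynomial (Fin (N + 1)) K)) := by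
  refine Ideal.add_mem _ ?_ (Ideal.pow_le_self (by omega) hΨ)
  obtain ⟨k, hk⟩ : ∃ k, μ = k + 1 := ⟨μ - 1, by omega⟩
  subst hk
  exact SecondOrderPoint.mem_span_of_isHomogeneous_succ K hΦ

/-- **The origin ideal `(ȳ)` of `K[y]/(Φ + Ψ)` is maximal.** [folklore] -/
theorem isMaximal_map_mk_span_range_X (K : Type) [Field K] {N : ℕ} (Φ Ψ : MvPolynomial (Fin (N + 1)) K) {μ : ℕ} (hμ : 1 ≤ μ)
    (hΦ : Φ.IsHomogeneous μ) (hΨ : Ψ ∈ Ideal.span (Set.range (X : Fin (N + 1) → MvPolynomial (Fin (N + 1)) K)) ^ (μ + 1)) :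
    (Ideal.map (Ideal.Quotient.mk (Ideal.span {Φ + Ψ}))
      (Ideal.span (Set.range (X : Fin (N + 1) → MvPolynomial (Fin (N + 1)) K)))).IsMaximal := by
  have hker : RingHom.ker (Ideal.Quotient.mk (Ideal.span {Φ + Ψ})) ≤
      Ideal.span (Set.range (X : Fin (N + 1) → MvPolynomial (Fin (N + 1)) K)) := by
    rw [Ideal.mk_ker]
    exact (Ideal.span_singleton_le_iff_mem _).mpr (add_mem_span_range_X K Φ Ψ hμ hΦ hΨ)
  rcases Ideal.map_eq_top_or_isMaximal_of_surjective (Ideal.Quotient.mk (Ideal.span {Φ + Ψ})) Ideal.Quotient.mk_surjective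
      (isMaximal_span_range_X' K (N := N)) with h | h
  · exfalso
    have hle : Ideal.comap (Ideal.Quotient.mk (Ideal.span {Φ + Ψ})) ⊥ ≤
        Ideal.span (Set.range (X : Fin (N + 1) → MvPolynomial (Fin (N + 1)) K)) := by
      intro g hg
      apply hker
      rw [RingHom.mem_ker]
      simpa using hg
    have hc := congrArg (Ideal.comap (Ideal.Quotient.mk (Ideal.span {Φ + Ψ}))) h
    rw [Ideal.comap_map_of_surjective _ Ideal.Quotient.mk_surjective, Ideal.comap_top, sup_eq_left.mpr hle] at hc
    exact (isMaximal_span_range_X' K (N := N)).ne_top hc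
  · exact h

/-- ★★★ **THE ORIGIN OF AN AFFINE HYPERSURFACE WITH ONE-STEP DATA IS A ONE-STEP POINT** (tower currency).  `f = Φ + Ψ ∈ K[y₀,…,y_N]`, `Φ ≠ 0` a form of
degree `μ ≥ 1`, `Ψ ∈ (y)^{μ+1}`, one-step data (hone); `y₀` the point of `Spec (K[y]/(f))` with ideal `(ȳ)`.  Then for every blow-up `τ : Z → Spec (K[y]/(f))`
along `vanishingIdeal {y₀}` and every `z` with `τ z = y₀`, the local ring `𝒪_{Z,z}` is regular. [OURS] [cite: StacksProject, Tag 0804]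
[cite: GortzWedhorn2020, Prop. 13.91] -/
theorem oneStepAt_origin (K : Type) [Field K] {N : ℕ} (Φ Ψ : MvPolynomial (Fin (N + 1)) K) {μ : ℕ} (hμ : 1 ≤ μ)
    (hΦ : Φ.IsHomogeneous μ) (hΦ0 : Φ ≠ 0)
    (hΨ : Ψ ∈ Ideal.span (Set.range (X : Fin (N + 1) → MvPolynomial (Fin (N + 1)) K)) ^ (μ + 1))
    (hone : ∀ a : Fin (N + 1), ∃ G : MvPolynomial (Fin (N + 1)) K,
      aeval (fun j => X a * Function.update (X : Fin (N + 1) → MvPolynomial (Fin (N + 1)) K) a 1 j) (Φ + Ψ) = X a ^ μ * G ∧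
      ∀ P : Ideal (MvPolynomial (Fin (N + 1)) K), P.IsPrime → (X a : MvPolynomial (Fin (N + 1)) K) ∈ P → G ∈ P → ∃ j, pderiv j G ∉ P)
    (y₀ : Spec (CommRingCat.of (MvPolynomial (Fin (N + 1)) K ⧸ Ideal.span {Φ + Ψ})))
    (hy₀ : y₀.asIdeal = Ideal.map (Ideal.Quotient.mk (Ideal.span {Φ + Ψ}))
      (Ideal.span (Set.range (X : Fin (N + 1) → MvPolynomial (Fin (N + 1)) K)))) :
    ∀ (hy : IsClosed ({y₀} : Set (Spec (CommRingCat.of (MvPolynomial (Fin (N + 1)) K ⧸ Ideal.span {Φ + Ψ})))))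
      (Z : Scheme.{0}) (τ : Z ⟶ Spec (CommRingCat.of (MvPolynomial (Fin (N + 1)) K ⧸ Ideal.span {Φ + Ψ}))),
      IsBlowup τ (vanishingIdeal ⟨{y₀}, hy⟩) → ∀ z : Z, τ z = y₀ → IsRegularLocalRing (Z.presheaf.stalk z) := by
  intro hy Z τ hτ z hz
  have hmax := isMaximal_map_mk_span_range_X K Φ Ψ hμ hΦ hΨ
  have hrad : (Ideal.map (Ideal.Quotient.mk (Ideal.span {Φ + Ψ}))
      (Ideal.span (Set.range (X : Fin (N + 1) → MvPolynomial (Fin (N + 1)) K)))).IsRadical := hmax.isPrime.isRadical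
  have hsing : ({y₀} : Set (Spec (CommRingCat.of (MvPolynomial (Fin (N + 1)) K ⧸ Ideal.span {Φ + Ψ})))) =
      PrimeSpectrum.zeroLocus ((Ideal.map (Ideal.Quotient.mk (Ideal.span {Φ + Ψ}))
        (Ideal.span (Set.range (X : Fin (N + 1) → MvPolynomial (Fin (N + 1)) K))) : Set _)) := by
    rw [← hy₀]
    exact singleton_eq_zeroLocus_of_isMaximal y₀ (hy₀ ▸ hmax)
  have hC : (⟨{y₀}, hy⟩ : Closeds (Spec (CommRingCat.of (MvPolynomial (Fin (N + 1)) K ⧸ Ideal.span {Φ + Ψ})))) =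
      ⟨PrimeSpectrum.zeroLocus ((Ideal.map (Ideal.Quotient.mk (Ideal.span {Φ + Ψ}))
        (Ideal.span (Set.range (X : Fin (N + 1) → MvPolynomial (Fin (N + 1)) K))) : Set _)), PrimeSpectrum.isClosed_zeroLocus _⟩ :=
    Closeds.ext hsing
  have hV : vanishingIdeal (⟨{y₀}, hy⟩ : Closeds (Spec (CommRingCat.of (MvPolynomial (Fin (N + 1)) K ⧸ Ideal.span {Φ + Ψ})))) =
      ofIdealTop (Ideal.map (Scheme.ΓSpecIso (CommRingCat.of (MvPolynomial (Fin (N + 1)) K ⧸ Ideal.span {Φ + Ψ}))).inv.hom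
        (Ideal.map (Ideal.Quotient.mk (Ideal.span {Φ + Ψ})) (Ideal.span (Set.range (X : Fin (N + 1) → MvPolynomial (Fin (N + 1)) K))))) := by
    rw [hC]
    exact vanishingIdeal_zeroLocus_eq_ofIdealTop_of_isRadical _ hrad
  have hzs : τ z ∈ ((vanishingIdeal (⟨{y₀}, hy⟩ : Closeds _)).support : Set _) := by
    rw [Scheme.IdealSheafData.coe_support_vanishingIdeal]
    exact hz
  rw [hV] at hτ hzs
  exact isRegularLocalRing_stalk_of_isBlowup_origin K Φ Ψ hΦ hΦ0 hΨ hone hτ z hzs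

end OneStep

end Summit.ResolutionOfSingularities.ResolutionOfSingularities.Cruxes.EquisingularLiftNat.Sections

end
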